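import Literature.NumberTheory.Sieve.ParityWave0OddLogChowlaComparisonLemmas
import Literature.NumberTheory.Sieve.ParityWave0OddLogChowlaFlat
import Literature.NumberTheory.Sieve.LinearEquationsInPrimesNormalForm
import Mathlib.NumberTheory.Harmonic.Bounds
import HarnessLib

/-!
# Odd-order logarithmic Chowla (Tao–Teräväinen 2018): Theorem 3.2 from Gowers uniformity

Topic `Literature/NumberTheory/Sieve`; fifth support file towards the named fact
`Literature.NumberTheory.Sieve.liouville_logCorrelation_isLittleO_of_odd` (**parity.S22**,
`ParityWave0.lean`): T. Tao, J. Teräväinen, *Odd order cases of the logarithmically averaged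
Chowla conjecture*, J. Théor. Nombres Bordeaux 30 (2018), 997–1015 (arXiv:1710.02112).
Everything here is PROVED; no definitions, no named facts.

**Theorem 3.2** (comparison of prime and integer dilates) of the source is proved here for the
correlations `f_x(a) = 𝔼^{log}_{n ≤ x} ∏_j λ(n + a h_j)` of the fact (`OddLogChowla.corrLogAvg`),
CONDITIONALLY on its Lemma 5.3 — the Gowers uniformity of the `W`-tricked von Mangoldt function,
Green–Tao 2010, Thm. 7.2, which is the tree's named fact
`Literature.NumberTheory.Sieve.GreenTao2010_gowersUniformity` (unproved beyond level `1`); the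
level needed for `k` shifts is `GreenTao2010_gowersUniformityAt (k - 1)` (`U^k`-control, cf.
Remark 1.4 of the source: "for the three-point case `k = 3` … we only need `U³`-uniformity"),
taken as a hypothesis:

* `OddLogChowla.abs_setLogAvg_dyadicPrimes_sub_le` — for `k ≥ 2`, shifts `h_j ≤ B` with
  `h_{i₀} = 0`, and every `ε > 0`: `∃ w₀ ∀ w ≥ w₀ ∃ M₀ ∀ H₊ ∃ x₀ ∀ x ≥ x₀ ∀ a ∈ [1, H₊] ∀ m` with
  `M₀ ≤ 2^m ≤ H₊`,
  `|𝔼^{log}_{2^m < p ≤ 2^{m+1}} f_x(ap) - 𝔼^{log}_{2^m < n ≤ 2^{m+1}, (n, W)=1} f_x(an)| ≤ ε`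
  (`W = ∏_{p ≤ w} p`), which is the printed hierarchy "`w` large depending on `ε`; `H₋` on
  `w, ε`; `x` on `H₊, H₋, w, ε`; then for any `a ≤ H₊` and `H₋ ≤ 2^m ≤ H₊`".

Steps (all as printed in §5): `OddLogChowla.abs_setLogAvg_primes_sub_le` (weights `1/p` versus
`Λ'(n)/(n · m log 2)`, the `W`-trick identity `Λ' = (W/φ(W)) Λ'_{b,W}`, perturbation of the
ratio), the error-sum estimate `OddLogChowla.abs_errorSum_le` of
`ParityWave0OddLogChowlaComparisonLemmas.lean` (residues modulo `W`, summation by parts), and the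
flat sums `OddLogChowla.abs_flat_le_of_uniformity`, `OddLogChowla.abs_flat_one_le_of_uniformity`
(shift-average + Lemma 5.2, `ParityWave0OddLogChowlaFlat.lean`, `ParityWave0OddLogChowlaGvN.lean`,
plus the uniformity hypothesis). No prime number theorem is used: within a dyadic block
`log p = m log 2 + O(1)`, and Bertrand's postulate gives a prime in each block.

## References
* T. Tao, J. Teräväinen, J. Théor. Nombres Bordeaux 30 (2018), Theorem 3.2 and §5 (its
  proof); Remark 1.4. [TaoTeravainenJTNB2018]
* B. Green, T. Tao, Ann. of Math. 171 (2010), Thm. 7.2, (5.1). [GreenTao2010]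
-/

noncomputable section

open Finset

namespace Literature.NumberTheory.Sieve

namespace OddLogChowla

/-! ### From the error sums to the comparison of the two logarithmic averages -/

/-- **Prime versus integer logarithmic averages, given the error-sum bounds.** Let `W ≥ 2`,
`s = 2^m` with `m ≥ 1` and `W ≤ s`, let every prime of `(s, 2s]` be coprime to `W`, `|F| ≤ 1`,
and suppose the error sums `E(G) = ∑_{n ∈ (s,2s], (n,W)=1} G(n)(Λ'_{b(n),W}(d(n)) - 1)/n` satisfy
`|E(F)|, |E(1)| ≤ δ ∑_{(n,W)=1} 1/n` with `δ ≤ 1/2`. Then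
`|𝔼^{log}_{p ∈ (s,2s]} F(p) - 𝔼^{log}_{n ∈ (s,2s], (n,W)=1} F(n)| ≤ 2/m + 4δ`
("Because `Λ(p) = log(2^m) + O(1)` …, we have `𝔼^{log}_p f(ap) = 𝔼^{log}_d f(ad) Λ(d) + O(ε)`";
then `Λ'(n) = (W/φ(W)) Λ'_{b,W}(d)` and the `W/φ(W)` cancels in the ratio).
[cite: TaoTeravainenJTNB2018, §5 (proof of Theorem 3.2, first three displays)] -/
theorem abs_setLogAvg_primes_sub_le {W : ℕ} (hW : 2 ≤ W) {m : ℕ} (hm : 1 ≤ m)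
    (hcop : ∀ p ∈ dyadicPrimes m, Nat.Coprime p W) {F : ℕ → ℝ} (hF : ∀ n, |F n| ≤ 1)
    {δ : ℝ} (hδ : δ ≤ 1 / 2)
    (hEF : |∑ n ∈ (Ioc (2 ^ m) (2 * 2 ^ m)).filter (fun n => Nat.Coprime n W),
        F n * (vonMangoldtW W (n % W) (n / W) - 1) / n| ≤
      δ * ∑ n ∈ (Ioc (2 ^ m) (2 * 2 ^ m)).filter (fun n => Nat.Coprime n W), (1 : ℝ) / n)
    (hE1 : |∑ n ∈ (Ioc (2 ^ m) (2 * 2 ^ m)).filter (fun n => Nat.Coprime n W),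
        (1 : ℝ) * (vonMangoldtW W (n % W) (n / W) - 1) / n| ≤
      δ * ∑ n ∈ (Ioc (2 ^ m) (2 * 2 ^ m)).filter (fun n => Nat.Coprime n W), (1 : ℝ) / n) :
    |setLogAvg (dyadicPrimes m) F -
      setLogAvg ((Ioc (2 ^ m) (2 ^ (m + 1))).filter (fun n => Nat.Coprime n W)) F| ≤
      2 / m + 4 * δ := by
  have h2s : 2 ^ (m + 1) = 2 * 2 ^ m := by rw [pow_succ, mul_comm]
  rw [h2s]
  set s : ℕ := 2 ^ m with hsdef
  set P := dyadicPrimes m with hPdef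
  set IW := (Ioc s (2 * s)).filter (fun n => Nat.Coprime n W) with hIW
  set D₁ : ℝ := ∑ n ∈ IW, (1 : ℝ) / n with hD₁
  set N₁ : ℝ := ∑ n ∈ IW, F n / n with hN₁
  set EF : ℝ := ∑ n ∈ IW, F n * (vonMangoldtW W (n % W) (n / W) - 1) / n with hEFdef
  set E1 : ℝ := ∑ n ∈ IW, (1 : ℝ) * (vonMangoldtW W (n % W) (n / W) - 1) / n with hE1def
  have hW1 : 1 ≤ W := by omega
  have hm0 : (0 : ℝ) < m := by exact_mod_cast hm
  have hlog2 : (0 : ℝ) < Real.log 2 := Real.log_pos one_lt_two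
  -- primes of `(s, 2s]`
  have hPmem : ∀ p ∈ P, (s < p ∧ p ≤ 2 * s) ∧ p.Prime := fun p hp => by
    have := (mem_dyadicPrimes (m := m) (p := p)).mp hp
    rwa [h2s] at this
  have hPne : P.Nonempty := by
    obtain ⟨p, hp, hsp, hp2⟩ := Nat.exists_prime_lt_and_le_two_mul s (by positivity)
    refine ⟨p, (mem_dyadicPrimes (m := m) (p := p)).mpr ⟨⟨hsp, ?_⟩, hp⟩⟩
    rwa [h2s]
  have hPpos : ∀ p ∈ P, (0 : ℝ) < p := fun p hp =>
    by exact_mod_cast lt_of_le_of_lt (Nat.zero_le s) (hPmem p hp).1.1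
  have hV : 0 < ∑ p ∈ P, (1 : ℝ) / p :=
    Finset.sum_pos (fun p hp => by have := hPpos p hp; positivity) hPne
  -- `IW.filter Prime = P`
  have hPIW : IW.filter Nat.Prime = P := by
    ext n
    rw [Finset.mem_filter, hIW, Finset.mem_filter, Finset.mem_Ioc, hPdef, mem_dyadicPrimes, h2s]
    constructor
    · rintro ⟨⟨hn, _⟩, hp⟩; exact ⟨hn, hp⟩
    · rintro ⟨hn, hp⟩
      refine ⟨⟨hn, hcop n ?_⟩, hp⟩
      rw [hPdef, mem_dyadicPrimes, h2s]; exact ⟨hn, hp⟩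
  have hDpos : 0 < D₁ := by
    have hsub : P ⊆ IW := by rw [← hPIW]; exact Finset.filter_subset _ _
    exact lt_of_lt_of_le hV (Finset.sum_le_sum_of_subset_of_nonneg hsub fun n _ _ => by positivity)
  -- the weights `ω(p) = log p / (m log 2) ∈ [1, 1 + 1/m]`
  set ω : ℕ → ℝ := fun p => Real.log p / (m * Real.log 2) with hωdef
  have hml : (0 : ℝ) < m * Real.log 2 := by positivity
  have hω : ∀ p ∈ P, 1 ≤ ω p ∧ ω p ≤ 1 + 1 / m := by
    intro p hp
    obtain ⟨⟨hsp, hp2⟩, _⟩ := hPmem p hp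
    have hlogp_lo : (m : ℝ) * Real.log 2 ≤ Real.log p := by
      rw [← Real.log_pow]
      exact Real.log_le_log (by positivity) (by exact_mod_cast hsp.le)
    have hlogp_hi : Real.log p ≤ ((m : ℝ) + 1) * Real.log 2 := by
      have : ((m : ℝ) + 1) * Real.log 2 = Real.log ((2 : ℝ) ^ (m + 1)) := by
        rw [Real.log_pow]; push_cast; ring
      rw [this]
      refine Real.log_le_log (hPpos p hp) ?_
      have : p ≤ 2 ^ (m + 1) := by rw [h2s]; exact hp2
      exact_mod_cast this
    constructor
    · rw [hωdef, le_div_iff₀ hml, one_mul]; exact hlogp_lo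
    · rw [hωdef, div_le_iff₀ hml]
      have : (1 + 1 / (m : ℝ)) * (m * Real.log 2) = (m + 1) * Real.log 2 := by
        field_simp
      rw [this]; exact hlogp_hi
  -- Step 1: replace the weights `1/p` by `ω(p)/p`
  have hstep1 := abs_weightedAvg_sub_le P (v := fun p => (1 : ℝ) / p) (ω := ω) (F := F)
    (η := 1 / m) (by positivity) (fun p hp => by have := hPpos p hp; positivity) hV hω
    (fun p _ => hF p)
  have hAvgP : (∑ p ∈ P, F p * (1 / (p : ℝ))) / (∑ p ∈ P, (1 : ℝ) / p) = setLogAvg P F := by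
    rw [setLogAvg]; congr 1; exact Finset.sum_congr rfl fun p _ => by ring
  -- Step 2: the `ω`-weighted sums are `κ (N₁ + E(F))`, `κ (D₁ + E(1))`
  set κ : ℝ := (W : ℝ) / Nat.totient W / (m * Real.log 2) with hκdef
  have hκ : 0 < κ := by
    have : (0 : ℝ) < Nat.totient W := by exact_mod_cast Nat.totient_pos.mpr (by omega)
    positivity
  have hident : ∀ G : ℕ → ℝ, ∑ p ∈ P, G p * (ω p * (1 / (p : ℝ))) =
      κ * (∑ n ∈ IW, G n / n + ∑ n ∈ IW, G n * (vonMangoldtW W (n % W) (n / W) - 1) / n) := by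
    intro G
    have h2 : ∑ n ∈ IW, G n * vonMangoldtPrime n / n =
        ∑ n ∈ IW.filter Nat.Prime, G n * Real.log n / n := by
      conv_rhs => rw [Finset.sum_filter]
      refine Finset.sum_congr rfl fun n _ => ?_
      unfold vonMangoldtPrime
      split_ifs <;> simp
    have h1 : ∑ p ∈ P, G p * (ω p * (1 / (p : ℝ))) =
        (1 / (m * Real.log 2)) * ∑ n ∈ IW, G n * vonMangoldtPrime n / n := by
      rw [h2, hPIW, Finset.mul_sum]
      refine Finset.sum_congr rfl fun p _ => ?_
      simp only [hωdef]; ring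
    rw [h1, ← Finset.sum_add_distrib]
    have h3 : ∀ n ∈ IW, G n * vonMangoldtPrime n / n =
        (W : ℝ) / Nat.totient W * (G n / n + G n * (vonMangoldtW W (n % W) (n / W) - 1) / n) := by
      intro n _
      rw [vonMangoldtPrime_eq_mul_vonMangoldtW hW1 n]; ring
    rw [Finset.sum_congr rfl h3, ← Finset.mul_sum, hκdef]; ring
  have hidF : ∑ p ∈ P, F p * (ω p * (1 / (p : ℝ))) = κ * (N₁ + EF) := hident F
  have hid1 : ∑ p ∈ P, ω p * (1 / (p : ℝ)) = κ * (D₁ + E1) := by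
    have := hident (fun _ => 1)
    rw [show (∑ p ∈ P, ω p * (1 / (p : ℝ))) = ∑ p ∈ P, (fun _ => (1 : ℝ)) p * (ω p * (1 / (p : ℝ)))
      from Finset.sum_congr rfl (fun p _ => by simp)]
    exact this
  have hratio : (∑ p ∈ P, F p * (ω p * (1 / (p : ℝ)))) / (∑ p ∈ P, ω p * (1 / (p : ℝ))) =
      (N₁ + EF) / (D₁ + E1) := by
    rw [hidF, hid1, mul_div_mul_left _ _ hκ.ne']
  -- Step 3: perturb the ratio
  have hN : |N₁| ≤ D₁ := by
    refine (Finset.abs_sum_le_sum_abs _ _).trans (Finset.sum_le_sum fun n _ => ?_)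
    rw [abs_div, Nat.abs_cast]
    exact div_le_div_of_nonneg_right (hF n) (Nat.cast_nonneg _)
  have hstep3 := abs_ratio_perturb_le hDpos hN hEF hE1 hδ
  have hAvgI : N₁ / D₁ = setLogAvg IW F := rfl
  -- assemble
  rw [hratio, hAvgP] at hstep1
  calc |setLogAvg P F - setLogAvg IW F|
      ≤ |setLogAvg P F - (N₁ + EF) / (D₁ + E1)| + |(N₁ + EF) / (D₁ + E1) - setLogAvg IW F| :=
        abs_sub_le _ _ _
    _ ≤ 2 * (1 / m) + 4 * δ := by
        refine add_le_add ?_ ?_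
        · rw [abs_sub_comm]; exact hstep1
        · rw [← hAvgI]; exact hstep3
    _ = 2 / m + 4 * δ := by ring

/-! ### Theorem 3.2 -/

/-- `log (x+1) ≤ ∑_{ν ≤ x} 1/ν`. [folklore] -/
theorem log_succ_le_sum_Icc_one_div (x : ℕ) :
    Real.log ((x : ℝ) + 1) ≤ ∑ ν ∈ Icc 1 x, (1 : ℝ) / ν := by
  have h := log_add_one_le_harmonic x
  rw [harmonic_eq_sum_Icc, Rat.cast_sum] at h
  push_cast at h
  refine h.trans (le_of_eq (Finset.sum_congr rfl fun ν _ => ?_))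
  rw [one_div]

/-- **The flat sum against `f_x`, given uniformity** (the bound (targ) of the source made
quantitative): if `‖Λ'_{b,W} - 1‖_{U^k[H]} ≤ ε₁` and `x` is so large that
`4aWH(1 + log(W(H+1))) ≤ ε₁ ∑_{ν ≤ x} 1/ν`, then
`|∑_{d ≤ H} (Λ'_{b,W}(d) - 1) f_x(a(Wd+b))| ≤ ((B+3)² + 1) ε₁ H`.
[cite: TaoTeravainenJTNB2018, §5 (proof of Theorem 3.2, (targ) and the last display)] -/
theorem abs_flat_le_of_uniformity {k : ℕ} (hk : 1 ≤ k) (h : Fin k → ℕ) {i₀ : Fin k}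
    (hi₀ : h i₀ = 0) {B : ℕ} (hB : ∀ j, h j ≤ B) {a W b x H : ℕ} (ha : 1 ≤ a) (hW : 1 ≤ W)
    (hbW : b ≤ W) (hH : 1 ≤ H) {ε₁ : ℝ} (hε₁ : 0 ≤ ε₁)
    (hu : uniformityNorm k H (fun z : ℤ => (((vonMangoldtW W b z.toNat - 1 : ℝ)) : ℂ)) ≤ ε₁)
    (hS : 4 * (a : ℝ) * W * H * (1 + Real.log ((W * (H + 1) : ℕ) : ℝ)) ≤
      ε₁ * ∑ ν ∈ Icc 1 x, (1 : ℝ) / ν) :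
    |∑ d ∈ Icc 1 H, (vonMangoldtW W b d - 1) * corrLogAvg h x (a * (W * d + b))| ≤
      ((((B + 3 : ℕ) : ℝ)) ^ 2 + 1) * ε₁ * H := by
  set θ : ℕ → ℝ := fun d => vonMangoldtW W b d - 1 with hθ
  have hflat := abs_sum_mul_corrLogAvg_le hk h hi₀ hB ha hW b x θ hH
  have hθsum : ∑ d ∈ Icc 1 H, |θ d| ≤ H * (1 + Real.log ((W * (H + 1) : ℕ) : ℝ)) :=
    sum_abs_vonMangoldtW_sub_one_le hW hbW
  have hH0 : (0 : ℝ) < H := by exact_mod_cast hH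
  have hlog0 : 0 ≤ Real.log ((W * (H + 1) : ℕ) : ℝ) := Real.log_natCast_nonneg _
  -- if the harmonic weight vanishes the shift term is `0`
  rcases (harmonicWeight_nonneg (Icc 1 x)).eq_or_lt with h0 | hSpos
  · rw [← h0, div_zero, add_zero] at hflat
    refine hflat.trans ?_
    calc (((B + 3 : ℕ) : ℝ)) ^ 2 * H * uniformityNorm k H (fun z : ℤ => ((θ z.toNat : ℝ) : ℂ))
        ≤ (((B + 3 : ℕ) : ℝ)) ^ 2 * H * ε₁ := mul_le_mul_of_nonneg_left hu (by positivity)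
      _ ≤ ((((B + 3 : ℕ) : ℝ)) ^ 2 + 1) * ε₁ * H := by nlinarith
  have hshift : 4 * ((a * W * H : ℕ) : ℝ) * (∑ d ∈ Icc 1 H, |θ d|) / (∑ ν ∈ Icc 1 x, (1 : ℝ) / ν)
      ≤ ε₁ * H := by
    rw [div_le_iff₀ hSpos]
    calc 4 * ((a * W * H : ℕ) : ℝ) * ∑ d ∈ Icc 1 H, |θ d|
        ≤ 4 * ((a * W * H : ℕ) : ℝ) * (H * (1 + Real.log ((W * (H + 1) : ℕ) : ℝ))) :=
          mul_le_mul_of_nonneg_left hθsum (by positivity)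
      _ = (4 * (a : ℝ) * W * H * (1 + Real.log ((W * (H + 1) : ℕ) : ℝ))) * H := by
          rw [Nat.cast_mul, Nat.cast_mul]; ring
      _ ≤ (ε₁ * ∑ ν ∈ Icc 1 x, (1 : ℝ) / ν) * H := mul_le_mul_of_nonneg_right hS hH0.le
      _ = ε₁ * H * ∑ ν ∈ Icc 1 x, (1 : ℝ) / ν := by ring
  refine hflat.trans ?_
  calc (((B + 3 : ℕ) : ℝ)) ^ 2 * H * uniformityNorm k H (fun z : ℤ => ((θ z.toNat : ℝ) : ℂ)) +
        4 * ((a * W * H : ℕ) : ℝ) * (∑ d ∈ Icc 1 H, |θ d|) / ∑ ν ∈ Icc 1 x, (1 : ℝ) / ν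
      ≤ (((B + 3 : ℕ) : ℝ)) ^ 2 * H * ε₁ + ε₁ * H :=
        add_le_add (mul_le_mul_of_nonneg_left hu (by positivity)) hshift
    _ = ((((B + 3 : ℕ) : ℝ)) ^ 2 + 1) * ε₁ * H := by ring

/-- **The flat sum against `1`, given uniformity**: `|∑_{d ≤ H} (Λ'_{b,W}(d) - 1)| ≤ (B+3)² ε₁ H`
when `‖Λ'_{b,W} - 1‖_{U^k[H]} ≤ ε₁` (Lemma 5.2 with all `φ_j = 1`).
[cite: TaoTeravainenJTNB2018, Lemma 5.2] -/
theorem abs_flat_one_le_of_uniformity {k : ℕ} (hk : 1 ≤ k) (h : Fin k → ℕ) {i₀ : Fin k}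
    (hi₀ : h i₀ = 0) {B : ℕ} (hB : ∀ j, h j ≤ B) {W b H : ℕ} (hH : 1 ≤ H) {ε₁ : ℝ}
    (hu : uniformityNorm k H (fun z : ℤ => (((vonMangoldtW W b z.toNat - 1 : ℝ)) : ℂ)) ≤ ε₁) :
    |∑ d ∈ Icc 1 H, (vonMangoldtW W b d - 1)| ≤ (((B + 3 : ℕ) : ℝ)) ^ 2 * ε₁ * H := by
  set θ : ℕ → ℝ := fun d => vonMangoldtW W b d - 1 with hθ
  have h1 := abs_sum_dilated_le hk h hi₀ hB (fun z : ℤ => θ z.toNat) (φ := fun _ _ => (1 : ℝ))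
    (by intros; simp) hH
  have heq : ∑ d ∈ Icc 1 H, ∑ n ∈ Icc 1 H,
      (fun z : ℤ => θ z.toNat) (d : ℤ) * ∏ j : Fin k, (fun _ _ => (1 : ℝ)) j (n + h j * d) =
      (H : ℝ) * ∑ d ∈ Icc 1 H, θ d := by
    rw [Finset.mul_sum]
    refine Finset.sum_congr rfl fun d _ => ?_
    simp only [Finset.prod_const_one, mul_one, Finset.sum_const, Nat.card_Icc,
      Nat.add_sub_cancel, nsmul_eq_mul, Int.toNat_natCast]
  rw [heq, abs_mul, Nat.abs_cast] at h1
  have hH0 : (0 : ℝ) < H := by exact_mod_cast hH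
  refine le_of_mul_le_mul_left (h1.trans ?_) hH0
  calc ((((B + 3) * H : ℕ) : ℝ)) ^ 2 * uniformityNorm k H (fun z : ℤ => ((θ z.toNat : ℝ) : ℂ))
      ≤ ((((B + 3) * H : ℕ) : ℝ)) ^ 2 * ε₁ :=
        mul_le_mul_of_nonneg_left hu (by positivity)
    _ = H * ((((B + 3 : ℕ) : ℝ)) ^ 2 * ε₁ * H) := by rw [Nat.cast_mul]; ring

set_option maxHeartbeats 400000 in -- a long `∀∃` assembly with many casts; twice the default suffices
/-- **Comparison of prime and integer dilates** (Tao–Teräväinen, J. Théor. Nombres Bordeaux 30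
(2018), **Theorem 3.2**, for the correlations `f_x(a) = 𝔼^{log}_{n ≤ x} ∏_j λ(n + a h_j)` of the
fact, i.e. `a_j = 1`, `b_j = h_j`, one shift being `0`), from the level-`(k-1)` Gowers uniformity
estimate for the `W`-tricked von Mangoldt function (Green–Tao 2010, Thm. 7.2 = the printed
Lemma 5.3; the tree's `GreenTao2010_gowersUniformityAt (k-1)`, a hypothesis here): for every
`ε > 0` there is `w₀` such that for `w ≥ w₀`, `W = ∏_{p ≤ w} p`, there is `M₀` such that for
every `H₊` there is `x₀` with
`|𝔼^{log}_{2^m < p ≤ 2^{m+1}} f_x(ap) - 𝔼^{log}_{2^m < n ≤ 2^{m+1}, (n,W)=1} f_x(an)| ≤ ε`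
whenever `x ≥ x₀`, `1 ≤ a ≤ H₊` and `M₀ ≤ 2^m ≤ H₊` ("Let `w` be sufficiently large depending on
`ε`; `H₋` sufficiently large depending on `w, ε`; … `x` sufficiently large depending on
`H₊, H₋, w, ε`. Then, for any natural number `a ≤ H₊` and any `m` with `H₋ ≤ 2^m ≤ H₊` …").
Proof as printed (§5): replace `𝔼^{log}_p` by `Λ'`-weighted sums, partition into residue
classes modulo `W` and sum by parts (`abs_errorSum_le`, `abs_setLogAvg_primes_sub_le`), and
bound the flat sums by shifting, averaging and Lemma 5.2 together with the uniformity hypothesis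
(`abs_flat_le_of_uniformity`, `abs_flat_one_le_of_uniformity`).
[cite: TaoTeravainenJTNB2018, Theorem 3.2] -/
theorem abs_setLogAvg_dyadicPrimes_sub_le {k : ℕ} (hk : 2 ≤ k)
    (hX : GreenTao2010_gowersUniformityAt (k - 1)) (h : Fin k → ℕ) {i₀ : Fin k}
    (hi₀ : h i₀ = 0) {B : ℕ} (hB : ∀ j, h j ≤ B) {ε : ℝ} (hε : 0 < ε) :
    ∃ w₀ : ℕ, ∀ w : ℕ, w₀ ≤ w → ∃ M₀ : ℕ, ∀ Hp : ℕ, ∃ x₀ : ℕ, ∀ x : ℕ, x₀ ≤ x →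
      ∀ a : ℕ, 1 ≤ a → a ≤ Hp → ∀ m : ℕ, M₀ ≤ 2 ^ m → 2 ^ m ≤ Hp →
        |setLogAvg (dyadicPrimes m) (fun p => corrLogAvg h x (a * p)) -
          setLogAvg ((Ioc (2 ^ m) (2 ^ (m + 1))).filter (fun n => Nat.Coprime n (primorial w)))
            (fun n => corrLogAvg h x (a * n))| ≤ ε := by
  -- constants
  set ε' : ℝ := min ε 1 with hε'def
  have hε' : 0 < ε' := lt_min hε one_pos
  have hε'1 : ε' ≤ 1 := min_le_right _ _
  have hε'ε : ε' ≤ ε := min_le_left _ _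
  set C : ℝ := (((B + 3 : ℕ) : ℝ)) ^ 2 + 1 with hCdef
  have hC1 : 1 ≤ C := by rw [hCdef]; nlinarith
  set ε₁ : ℝ := ε' / (128 * C) with hε₁def
  have hε₁ : 0 < ε₁ := by positivity
  have hk1 : k - 1 + 1 = k := by omega
  obtain ⟨w₀X, N₀, hXP⟩ := hX ε₁ hε₁
  refine ⟨max w₀X 2, fun w hw => ?_⟩
  have hw2 : 2 ≤ w := le_of_max_le_right hw
  have hwX : w₀X ≤ w := le_of_max_le_left hw
  have hW2 : 2 ≤ primorial w := by
    have := primorial_mono hw2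
    rwa [primorial_two] at this
  set W : ℕ := primorial w with hWdef
  have hW1 : 1 ≤ W := by omega
  have hwW : w ≤ W := le_primorial_self
  set T : ℕ := ⌈Real.exp (Real.exp (2 * (w : ℝ)))⌉₊ with hTdef
  refine ⟨max (2 * W * (N₀ + T + 2)) (2 ^ ⌈8 / ε'⌉₊), fun Hp => ?_⟩
  set S₀ : ℝ := 4 * (Hp : ℝ) * W * Hp * (1 + Real.log ((W * (Hp + 1) : ℕ) : ℝ)) / ε₁ with hS₀def
  refine ⟨⌈Real.exp S₀⌉₊, fun x hx a ha haH m hM₀ hmH => ?_⟩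
  have hs1 : 2 * W * (N₀ + T + 2) ≤ 2 ^ m := le_of_max_le_left hM₀
  have hs2 : 2 ^ ⌈8 / ε'⌉₊ ≤ 2 ^ m := le_of_max_le_right hM₀
  set s : ℕ := 2 ^ m with hsdef
  have hm : ⌈8 / ε'⌉₊ ≤ m := (Nat.pow_le_pow_iff_right (by norm_num : 1 < 2)).mp hs2
  have hm8 : 8 / ε' ≤ m := (Nat.le_ceil _).trans (by exact_mod_cast hm)
  have hm1 : 1 ≤ m := by
    have : (1 : ℝ) ≤ 8 / ε' := by rw [le_div_iff₀ hε']; linarith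
    exact_mod_cast this.trans hm8
  have hsW : 2 * W ≤ s := le_trans (Nat.le_mul_of_pos_right _ (by omega)) hs1
  have hWs : W ≤ s := by omega
  have hHp1 : 1 ≤ Hp := ha.trans haH
  have hW0 : (0 : ℝ) < W := by exact_mod_cast (show 0 < W by omega)
  -- `S_x ≥ S₀ > 0`
  have hlogHp : 0 ≤ Real.log ((W * (Hp + 1) : ℕ) : ℝ) := Real.log_natCast_nonneg _
  have hS₀pos : 0 < S₀ := by positivity
  have hSx : S₀ ≤ ∑ ν ∈ Icc 1 x, (1 : ℝ) / ν := by
    refine le_trans ?_ (log_succ_le_sum_Icc_one_div x)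
    have h1 : Real.exp S₀ ≤ x := (Nat.le_ceil _).trans (by exact_mod_cast hx)
    calc S₀ = Real.log (Real.exp S₀) := (Real.log_exp _).symm
      _ ≤ Real.log ((x : ℝ) + 1) := Real.log_le_log (Real.exp_pos _) (by linarith)
  -- the flat-sum hypotheses of `abs_errorSum_le`
  set F : ℕ → ℝ := fun n => corrLogAvg h x (a * n) with hFdef
  set One : ℕ → ℝ := fun _ => 1 with hOnedef
  have key : ∀ b ∈ (Finset.range W).filter (fun b => Nat.Coprime b W), ∀ H : ℕ,
      (s - b) / W ≤ H → H ≤ (2 * s - b) / W →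
      |∑ d ∈ Icc 1 H, (vonMangoldtW W b d - 1) * F (W * d + b)| ≤ (2 * C * ε₁) * (s / W : ℝ) ∧
      |∑ d ∈ Icc 1 H, (vonMangoldtW W b d - 1) * One (W * d + b)| ≤
        (2 * C * ε₁) * (s / W : ℝ) := by
    intro b hb H hH1 hH2
    rw [Finset.mem_filter, Finset.mem_range] at hb
    have hb1 : 1 ≤ b := by
      rw [Nat.one_le_iff_ne_zero]; rintro rfl
      have := hb.2; rw [Nat.coprime_zero_left] at this; omega
    -- size of `H`
    have hsWdiv : 2 * (N₀ + T + 2) ≤ s / W := by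
      rw [Nat.le_div_iff_mul_le (by omega)]
      calc 2 * (N₀ + T + 2) * W = 2 * W * (N₀ + T + 2) := by ring
        _ ≤ s := hs1
    have hsub : s / W - 1 ≤ (s - b) / W := by
      rw [← Nat.sub_mul_div s W 1, mul_one]
      exact Nat.div_le_div_right (by omega)
    have hHN : N₀ ≤ H := by omega
    have hHT : T ≤ H := by omega
    have hH1' : 1 ≤ H := by omega
    have hHs : H ≤ s := by
      refine hH2.trans ?_
      calc (2 * s - b) / W ≤ (2 * s) / W := Nat.div_le_div_right (Nat.sub_le _ _)
        _ ≤ (2 * s) / 2 := Nat.div_le_div_left hW2 (by norm_num)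
        _ = s := by omega
    have hHHp : H ≤ Hp := hHs.trans hmH
    have hHreal : (H : ℝ) ≤ 2 * s / W := by
      have h1 : ((2 * s - b) / W : ℕ) ≤ 2 * s / W := Nat.div_le_div_right (Nat.sub_le _ _)
      have h2 : (((2 * s) / W : ℕ) : ℝ) ≤ ((2 * s : ℕ) : ℝ) / (W : ℝ) := Nat.cast_div_le
      rw [Nat.cast_mul] at h2
      calc (H : ℝ) ≤ ((2 * s / W : ℕ) : ℝ) := by exact_mod_cast hH2.trans h1
        _ ≤ 2 * s / W := by exact_mod_cast h2
    -- the Gowers uniformity input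
    have hloglog : (w : ℝ) ≤ Real.log (Real.log H) / 2 := by
      have hT1 : Real.exp (Real.exp (2 * (w : ℝ))) ≤ H :=
        le_trans (Nat.le_ceil _) (Nat.cast_le.mpr hHT)
      have h1 : Real.exp (2 * (w : ℝ)) ≤ Real.log H := by
        rw [← Real.log_exp (Real.exp (2 * (w : ℝ)))]
        exact Real.log_le_log (Real.exp_pos _) hT1
      have h2 : (2 * (w : ℝ)) ≤ Real.log (Real.log H) := by
        rw [← Real.log_exp (2 * (w : ℝ))]
        exact Real.log_le_log (Real.exp_pos _) h1
      linarith
    have hu : uniformityNorm k H (fun z : ℤ => (((vonMangoldtW W b z.toNat - 1 : ℝ)) : ℂ)) ≤ ε₁ := by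
      have := hXP H hHN w hwX hloglog b hb1 hb.1.le hb.2
      rw [hk1] at this
      exact this
    -- the largeness of `x`
    have hS : 4 * (a : ℝ) * W * H * (1 + Real.log ((W * (H + 1) : ℕ) : ℝ)) ≤
        ε₁ * ∑ ν ∈ Icc 1 x, (1 : ℝ) / ν := by
      refine le_trans ?_ (mul_le_mul_of_nonneg_left hSx hε₁.le)
      have h3 : ε₁ * S₀ = 4 * (Hp : ℝ) * W * Hp * (1 + Real.log ((W * (Hp + 1) : ℕ) : ℝ)) := by
        rw [hS₀def]; field_simp
      rw [h3]
      have haH' : (a : ℝ) ≤ Hp := by exact_mod_cast haH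
      have hHHp' : (H : ℝ) ≤ Hp := by exact_mod_cast hHHp
      have hlog0 : 0 ≤ Real.log ((W * (H + 1) : ℕ) : ℝ) := Real.log_natCast_nonneg _
      have hlogmono : Real.log ((W * (H + 1) : ℕ) : ℝ) ≤ Real.log ((W * (Hp + 1) : ℕ) : ℝ) :=
        Real.log_le_log (by exact_mod_cast (show 0 < W * (H + 1) by positivity))
          (by exact_mod_cast (show W * (H + 1) ≤ W * (Hp + 1) by nlinarith))
      have h4 : (4 : ℝ) * a * W * H ≤ 4 * Hp * W * Hp := by
        have := hW0.le
        calc (4 : ℝ) * a * W * H ≤ 4 * Hp * W * H := by gcongr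
          _ ≤ 4 * Hp * W * Hp := by gcongr
      calc (4 : ℝ) * a * W * H * (1 + Real.log ((W * (H + 1) : ℕ) : ℝ))
          ≤ 4 * Hp * W * Hp * (1 + Real.log ((W * (H + 1) : ℕ) : ℝ)) :=
            mul_le_mul_of_nonneg_right h4 (by linarith)
        _ ≤ 4 * Hp * W * Hp * (1 + Real.log ((W * (Hp + 1) : ℕ) : ℝ)) :=
            mul_le_mul_of_nonneg_left (by linarith) (by positivity)
    have hCε : C * ε₁ * H ≤ 2 * C * ε₁ * (s / W : ℝ) := by
      calc C * ε₁ * H ≤ C * ε₁ * (2 * s / W) := mul_le_mul_of_nonneg_left hHreal (by positivity)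
        _ = 2 * C * ε₁ * (s / W) := by ring
    constructor
    · have hA := abs_flat_le_of_uniformity (k := k) (by omega) h hi₀ hB ha hW1 hb.1.le hH1'
        hε₁.le hu hS
      have heq : ∑ d ∈ Icc 1 H, (vonMangoldtW W b d - 1) * F (W * d + b) =
          ∑ d ∈ Icc 1 H, (vonMangoldtW W b d - 1) * corrLogAvg h x (a * (W * d + b)) := rfl
      rw [heq]
      refine hA.trans (le_trans (le_of_eq ?_) hCε)
      rw [hCdef]
    · have hA := abs_flat_one_le_of_uniformity (k := k) (by omega) h hi₀ hB hH1' hu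
      have heq : ∑ d ∈ Icc 1 H, (vonMangoldtW W b d - 1) * One (W * d + b) =
          ∑ d ∈ Icc 1 H, (vonMangoldtW W b d - 1) := by
        refine Finset.sum_congr rfl fun d _ => ?_
        rw [hOnedef]; ring
      rw [heq]
      refine hA.trans (le_trans ?_ hCε)
      rw [hCdef]
      have h0 : (0 : ℝ) ≤ ε₁ * H := by positivity
      have h1 : ((((B + 3 : ℕ) : ℝ)) ^ 2 + 1) * ε₁ * H =
          (((B + 3 : ℕ) : ℝ)) ^ 2 * ε₁ * H + ε₁ * H := by ring
      rw [h1]; linarith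
  -- the error sums
  have hτ : 0 ≤ 2 * C * ε₁ := by positivity
  have hEF := abs_errorSum_le (W := W) (s := s) hW2 hsW F (τ := 2 * C * ε₁) hτ
    (fun b hb H h1 h2 => (key b hb H h1 h2).1)
  have hE1 := abs_errorSum_le (W := W) (s := s) hW2 hsW One (τ := 2 * C * ε₁) hτ
    (fun b hb H h1 h2 => (key b hb H h1 h2).2)
  have hcopP : ∀ p ∈ dyadicPrimes m, Nat.Coprime p W := by
    intro p hp
    rw [mem_dyadicPrimes] at hp
    exact coprime_primorial_of_lt hp.2 (lt_of_le_of_lt (hwW.trans hWs) hp.1.1)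
  have hδ : 8 * (2 * C * ε₁) ≤ 1 / 2 := by
    have : 8 * (2 * C * ε₁) = ε' / 8 := by rw [hε₁def]; field_simp; ring
    rw [this]; linarith
  have hF1 : ∀ n, |F n| ≤ 1 := fun n => abs_corrLogAvg_le_one h x (a * n)
  have hmain := abs_setLogAvg_primes_sub_le (W := W) (m := m) hW2 hm1 hcopP (F := F) hF1
    (δ := 8 * (2 * C * ε₁)) hδ hEF hE1
  refine hmain.trans ?_
  -- `2/m + 4 · 16 C ε₁ ≤ ε'/4 + ε'/2 ≤ ε`
  have hm0 : (0 : ℝ) < m := by exact_mod_cast hm1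
  have h1 : (2 : ℝ) / m ≤ ε' / 4 := by
    rw [div_le_iff₀ hm0]
    rw [div_le_iff₀ hε'] at hm8
    linarith
  have h2 : 4 * (8 * (2 * C * ε₁)) = ε' / 2 := by
    rw [hε₁def]; field_simp; ring
  linarith

end OddLogChowla

end Literature.NumberTheory.Sieve
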